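import Summits.MatrixMultiplication.MatrixMultiplication.Theses.DeterminantalIdealExponent
import Literature.Computability.AlgebraicComplexity.RazElusiveGeneralRouteProofs

/-!
# Crux `CheapIdealMember` (stmt-MatrixMultiplication-7708) — `Lines/border_lift.lean` (strategist line, gen 1)

Route `DeterminantalIdealExponent` (route-MatrixMultiplication-DeterminantalIdealExponent); deciding theorem
`closes : AndrewsLifting → CheapIdealMember → MatrixMultiplication` (route file, Bini bookkeeping);
`AndrewsLifting` (stmt-7709) is PROVED.  The crux, verbatim:

  `CheapIdealMember : ∀ ε > 0, ∃ᶠ r, ∃ g ≠ 0, (complexity (g * detPoly (Fin r) ℂ) : ℝ) ≤ r ^ (2 + ε)`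

(`complexity` = least size of a division-free fan-in-two `ArithCircuit` over the coefficient field).

## The line: DEBORDER THROUGH ω (the border sibling, registered as a line on THIS crux)

Andrews' Theorem 3 is printed at BORDER strength (Andrews 2022, Def. 4 + Thm. 3: a circuit over `𝔽(ε)`
computing `f + ε·g(x, ε)`, `g ∈ 𝔽[x, ε]`, for a nonzero `f ∈ I^det` has ≥ `bR(⟨r/4⟩)/6` product gates); the
tree vendors only the exact-complexity weakening (`Andrews2022_thm3`, faithfulness note "WEAKER THAN
PRINTED").  In the tree's existing vocabulary a border computation of `f ∈ ℂ[X_r]` is EXACTLY an exact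
computation, over the field `RatFunc ℂ = ℂ(ε)`, of `map P` for some `P ∈ ℂ[ε][X_r]`
(`MvPolynomial (Fin r × Fin r) (Polynomial ℂ)`) with `P|_{ε=0} = f`; no new definition is needed.

* `stub_border_witness` (OPEN — the bet; the crux RELAXED to border currency `C⁻`): for every `ε > 0`,
  frequently in `r`, some `P ∈ ℂ[ε][X_r]` whose specialisation `P(0)` is a NONZERO multiple of `det X_r`
  has `complexity_{ℂ(ε)} (P) ≤ r^(2+ε)`.  `CheapIdealMember → C⁻` is the sorry-free remark
  `border_witness_of_cheapIdealMember` below (constants along `ℂ → ℂ[ε] → ℂ(ε)`, `complexity_map_le`), so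
  `C⁻` is weaker than the crux; it is NOT cheaply equivalent to it (the way back is stubs 2+3+Bini).
  WHY EASIER (the teeth of the switch): over `ℂ(ε)` the circuit may use the constants `ε^{-k}`, so
  `P = ε^{-k}·Q_ε·det T_ε(X)` for ANY cheap pencil `T_ε` whose `ε`-leading determinant coefficient lies in
  `(det X_r)` is admissible — corank-jump / degenerate pencils (`det T₀ ≡ 0`, the attractor of every
  numerical search on the companion crux HiddenCorners, census gen-3 T9/§6.4) and sums of maximal minors
  `Σ ± T₀^{ÎĴ}(T₁)_{IJ}` become witnesses, whereas every EXACT structured witness class on record is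
  ω-neutral by theorem (Negative/KroneckerNeutral, Negative/TwoSidedKernelInjective, ToeplitzLikeDetCost +
  Schur-complement inheritance).  The border no-go ("border collapse", census §6.4) is NOT closed: it
  stops at an unresolved "interior-kernel tower".
* `stub_andrews_border` (XL formalisation, PUBLISHED: Andrews 2022 Thm. 3 at printed strength, square
  principal case): `P(0) ≠ 0`, `det X_r ∣ P(0)` ⇒ `bR(⟨⌊r/4⌋,⌊r/4⌋,⌊r/4⌋⟩) ≤ 6 · complexity_{ℂ(ε)}(P)`.
  Same constants as the tree's exact `Andrews2022_thm3` (whose proof `Andrews2022_thm3_holds` is the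
  template: AF22 straightening is already a border argument; what changes is that the input circuit lives
  over `ℂ(ε)` and the two infinitesimals must be merged, `ε ↦ ε^M·δ`, Andrews §3 proof of Thm. 3).
* `stub_fastDetMultiple` (L, folklore; BY NAME the route's support item `FastDetMultiple`, stmt-7713):
  nonzero multiples of `det X_r` of cost `C_ε r^(ω+ε)` (pivot-accumulating block elimination, BCS Thm 16.7
  made division-free).  It converts `ω(ℂ) = 2` back into the crux's exact currency.

Composition (sorry-free): `omega_eq_two_of_border` — stubs 1+2 + Bini (`Blaser2013_thm66_holds.cubic`,
PROVED) give `ω(ℂ) ≤ 2 + η` for every `η > 0` exactly as in the route's `closes`, hence `ω(ℂ) = 2`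
(`omega_two_le`); `cheapIdealMember_of_omega_eq_two` — stub 3 at `ε/2` then gives multiples of cost
`C·r^(2+ε/2) ≤ r^(2+ε)` eventually, hence frequently; `CheapIdealMember_of_stubs` chains them (explicit
hypotheses, conclusion = the crux unfolded) and `CheapIdealMember_of : CheapIdealMember` — the crux BY
NAME — is the registered skeleton theorem (the only theorem here concluding the route decl by name).

Disproof used: no `Disproof.lean` exists for stmt-7708 (2026-08-17); `ledger negatives --problem
MatrixMultiplication` has no statement about border complexity of ideal members.  Landed Negative lemmas of
the companion crux (KroneckerNeutral, TwoSidedKernelInjective) concern EXACT linear pencils with constant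
one- or two-sided certificates; stub 1 quantifies over no such structure.
-/

namespace Summit.MatrixMultiplication.MatrixMultiplication.Cruxes.CheapIdealMember.BorderLift

open Filter
open Literature.Computability.AlgebraicComplexity (complexity detPoly algBorderRank matMulTensor
  omega_two_le Blaser2013_thm66_holds)
open Summit.MatrixMultiplication.MatrixMultiplication.Theses.DeterminantalIdealExponent
  (CheapIdealMember FastDetMultiple)

/-! ## The three registered stubs -/

/-- **stub 1 — cheap BORDER ideal member (`C⁻`, OPEN; the bet).**  For every `ε > 0`, for infinitely
many `r`, there is `P ∈ ℂ[ε][X_r]` whose specialisation at `ε = 0` is a nonzero multiple of `det X_r` and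
whose division-free fan-in-two complexity over the field `ℂ(ε)` is at most `r^(2+ε)` — i.e. (Andrews 2022
Def. 4) some nonzero `f ∈ (det X_r)` has border complexity `≤ r^(2+ε)`.  Weaker than the crux
(`border_witness_of_cheapIdealMember`); equivalent to it only through stubs 2 and 3.
[cite: Andrews2022, Def. 4; Burgisser2004, Def. 3.1 (approximative complexity)] -/
theorem stub_border_witness :
    ∀ ε : ℝ, 0 < ε → ∃ᶠ r : ℕ in Filter.atTop,
      ∃ P : MvPolynomial (Fin r × Fin r) (Polynomial ℂ),
        MvPolynomial.map (Polynomial.evalRingHom 0) P ≠ 0 ∧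
        detPoly (Fin r) ℂ ∣ MvPolynomial.map (Polynomial.evalRingHom 0) P ∧
        (complexity (MvPolynomial.map (algebraMap (Polynomial ℂ) (RatFunc ℂ)) P) : ℝ) ≤
          (r : ℝ) ^ (2 + ε) := by
  sorry

/-- **stub 2 — Andrews' lifting at printed (border) strength, square principal case (XL, published).**
If `P ∈ ℂ[ε][X_r]` specialises at `ε = 0` to a nonzero multiple of `det X_r`, then every division-free
fan-in-two circuit over `ℂ(ε)` computing `P` has size `≥ bR(⟨⌊r/4⌋,⌊r/4⌋,⌊r/4⌋⟩)/6` (size ≥ number of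
product gates ≥ border multiplicative complexity of `P(0)`; Andrews 2022 Thm. 3 with Def. 1, Def. 4,
Lemma 7; `bR = algBorderRank` over `ℂ[ε]`, Bläser Def. 6.1).  The exact-currency weakening is the tree's
PROVED `Andrews2022_thm3_holds`; this is the printed strength its faithfulness note defers.
[cite: Andrews2022, Thm. 3 (Def. 4, Lemma 7, Lemma 8, Prop. 2)] -/
theorem stub_andrews_border :
    ∀ (r : ℕ) (P : MvPolynomial (Fin r × Fin r) (Polynomial ℂ)),
      MvPolynomial.map (Polynomial.evalRingHom 0) P ≠ 0 →
      detPoly (Fin r) ℂ ∣ MvPolynomial.map (Polynomial.evalRingHom 0) P →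
      algBorderRank (matMulTensor ℂ (r / 4) (r / 4) (r / 4)) ≤
        6 * complexity (MvPolynomial.map (algebraMap (Polynomial ℂ) (RatFunc ℂ)) P) := by
  sorry

/-- **stub 3 — fast nonzero determinant multiples (L, folklore) = the route's support item
`FastDetMultiple` (stmt-MatrixMultiplication-7713) BY NAME**: for every `ε > 0` there is `C` with, for
every `r ≥ 1`, a nonzero `g` such that `complexity (g · det X_r) ≤ C · r^(ω(ℂ)+ε)` (pivot-accumulating
block elimination, division-free; BCS Thm. 16.7 + Strassen 1973, or Blaser2013 Thm. 5.2).
[cite: BurgisserClausenShokrollahi1997, Thm. 16.7; Strassen1973; Blaser2013, Thm. 5.2] -/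
theorem stub_fastDetMultiple : FastDetMultiple := by
  sorry

/-! ## Sorry-free composition down to the crux BY NAME -/

/-- Step 1 of the composition: stubs 1 + 2 and Bini's theorem (`Blaser2013_thm66_holds`, PROVED) give
`ω(ℂ) = 2` — the route's `closes` bookkeeping with `complexity_{ℂ(ε)}(P)` in place of
`complexity(g · det X_r)`. [cite: Blaser2013, Thm. 6.6; Andrews2022, Thm. 3] -/
theorem omega_eq_two_of_border
    (h₁ : ∀ ε : ℝ, 0 < ε → ∃ᶠ r : ℕ in Filter.atTop,
      ∃ P : MvPolynomial (Fin r × Fin r) (Polynomial ℂ),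
        MvPolynomial.map (Polynomial.evalRingHom 0) P ≠ 0 ∧
        detPoly (Fin r) ℂ ∣ MvPolynomial.map (Polynomial.evalRingHom 0) P ∧
        (complexity (MvPolynomial.map (algebraMap (Polynomial ℂ) (RatFunc ℂ)) P) : ℝ) ≤
          (r : ℝ) ^ (2 + ε))
    (h₂ : ∀ (r : ℕ) (P : MvPolynomial (Fin r × Fin r) (Polynomial ℂ)),
      MvPolynomial.map (Polynomial.evalRingHom 0) P ≠ 0 →
      detPoly (Fin r) ℂ ∣ MvPolynomial.map (Polynomial.evalRingHom 0) P →
      algBorderRank (matMulTensor ℂ (r / 4) (r / 4) (r / 4)) ≤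
        6 * complexity (MvPolynomial.map (algebraMap (Polynomial ℂ) (RatFunc ℂ)) P)) :
    Literature.Computability.AlgebraicComplexity.omega ℂ = 2 := by
  refine le_antisymm ?_ (omega_two_le ℂ)
  refine le_of_forall_pos_le_add fun ε hε => ?_
  have hε2 : (0 : ℝ) < ε / 2 := by positivity
  have hA0 : (0 : ℝ) < 6 * (8 : ℝ) ^ (2 + ε / 2) := by positivity
  obtain ⟨r, ⟨P, hP0, hPd, hc⟩, hr⟩ := ((h₁ (ε / 2) hε2).and_eventually
    (Filter.eventually_ge_atTop (4 * ⌈(6 * (8 : ℝ) ^ (2 + ε / 2)) ^ (2 / ε)⌉₊ + 8))).exists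
  -- name the border cost
  set s : ℕ := complexity (MvPolynomial.map (algebraMap (Polynomial ℂ) (RatFunc ℂ)) P) with hs
  have hq2 : 2 ≤ r / 4 := by omega
  have hqN : ⌈(6 * (8 : ℝ) ^ (2 + ε / 2)) ^ (2 / ε)⌉₊ ≤ r / 4 := by omega
  have hr8 : r ≤ 8 * (r / 4) := by omega
  have hq1 : (1 : ℝ) < ((r / 4 : ℕ) : ℝ) := by exact_mod_cast (by omega : 1 < r / 4)
  have hq0 : (0 : ℝ) < ((r / 4 : ℕ) : ℝ) := by positivity
  have hr8' : (r : ℝ) ≤ 8 * ((r / 4 : ℕ) : ℝ) := by exact_mod_cast hr8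
  -- Bini's theorem (Blaser2013 Thm 6.6, cubic form) at q = ⌊r/4⌋ and ρ = max (6·s) 1
  have hρ1 : 1 ≤ max (6 * s) 1 := le_max_right _ _
  have hbr : algBorderRank (matMulTensor ℂ (r / 4) (r / 4) (r / 4)) ≤ max (6 * s) 1 :=
    (h₂ r P hP0 hPd).trans (le_max_left _ _)
  have hω := Blaser2013_thm66_holds.cubic ℂ hq2 hρ1 hbr
  -- the arithmetic ρ ≤ q^(2+ε)
  have hAq : 6 * (8 : ℝ) ^ (2 + ε / 2) ≤ ((r / 4 : ℕ) : ℝ) ^ (ε / 2) := by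
    have hN : (6 * (8 : ℝ) ^ (2 + ε / 2)) ^ (2 / ε) ≤ ((r / 4 : ℕ) : ℝ) :=
      (Nat.le_ceil _).trans (by exact_mod_cast hqN)
    have h1 : ((6 * (8 : ℝ) ^ (2 + ε / 2)) ^ (2 / ε)) ^ (ε / 2) ≤ ((r / 4 : ℕ) : ℝ) ^ (ε / 2) :=
      Real.rpow_le_rpow (by positivity) hN hε2.le
    have h2 : ((6 * (8 : ℝ) ^ (2 + ε / 2)) ^ (2 / ε)) ^ (ε / 2) = 6 * (8 : ℝ) ^ (2 + ε / 2) := by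
      rw [← Real.rpow_mul hA0.le]
      have : 2 / ε * (ε / 2) = 1 := by field_simp
      rw [this, Real.rpow_one]
    rwa [h2] at h1
  have hsplit : ((r / 4 : ℕ) : ℝ) ^ (2 + ε) =
      ((r / 4 : ℕ) : ℝ) ^ (ε / 2) * ((r / 4 : ℕ) : ℝ) ^ (2 + ε / 2) := by
    rw [← Real.rpow_add hq0]; congr 1; ring
  have hc6 : ((6 * s : ℕ) : ℝ) ≤ 6 * (8 : ℝ) ^ (2 + ε / 2) * ((r / 4 : ℕ) : ℝ) ^ (2 + ε / 2) := by
    push_cast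
    calc (6 : ℝ) * (s : ℝ)
          ≤ 6 * (r : ℝ) ^ (2 + ε / 2) := mul_le_mul_of_nonneg_left hc (by norm_num)
      _ ≤ 6 * ((8 : ℝ) * ((r / 4 : ℕ) : ℝ)) ^ (2 + ε / 2) :=
          mul_le_mul_of_nonneg_left (Real.rpow_le_rpow (Nat.cast_nonneg r) hr8' (by positivity))
            (by norm_num)
      _ = 6 * (8 : ℝ) ^ (2 + ε / 2) * ((r / 4 : ℕ) : ℝ) ^ (2 + ε / 2) := by
          rw [Real.mul_rpow (by norm_num) hq0.le]; ring
  have hone : (1 : ℝ) ≤ 6 * (8 : ℝ) ^ (2 + ε / 2) * ((r / 4 : ℕ) : ℝ) ^ (2 + ε / 2) := by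
    have h8 : (1 : ℝ) ≤ (8 : ℝ) ^ (2 + ε / 2) := Real.one_le_rpow (by norm_num) (by positivity)
    have h1 : (1 : ℝ) ≤ ((r / 4 : ℕ) : ℝ) ^ (2 + ε / 2) := Real.one_le_rpow hq1.le (by positivity)
    nlinarith
  have hρA : ((max (6 * s) 1 : ℕ) : ℝ) ≤
      6 * (8 : ℝ) ^ (2 + ε / 2) * ((r / 4 : ℕ) : ℝ) ^ (2 + ε / 2) := by
    rcases le_total (6 * s) 1 with h | h
    · rw [max_eq_right h]; simpa using hone
    · rw [max_eq_left h]; exact hc6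
  have hρle : ((max (6 * s) 1 : ℕ) : ℝ) ≤ ((r / 4 : ℕ) : ℝ) ^ (2 + ε) := by
    calc _ ≤ 6 * (8 : ℝ) ^ (2 + ε / 2) * ((r / 4 : ℕ) : ℝ) ^ (2 + ε / 2) := hρA
      _ ≤ ((r / 4 : ℕ) : ℝ) ^ (ε / 2) * ((r / 4 : ℕ) : ℝ) ^ (2 + ε / 2) :=
          mul_le_mul_of_nonneg_right hAq (by positivity)
      _ = ((r / 4 : ℕ) : ℝ) ^ (2 + ε) := hsplit.symm
  have hρpos : (0 : ℝ) < ((max (6 * s) 1 : ℕ) : ℝ) := by exact_mod_cast hρ1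
  calc Literature.Computability.AlgebraicComplexity.omega ℂ ≤ _ := hω
    _ ≤ Real.logb ((r / 4 : ℕ) : ℝ) (((r / 4 : ℕ) : ℝ) ^ (2 + ε)) :=
        Real.logb_le_logb_of_le hq1 hρpos hρle
    _ = 2 + ε := Real.logb_rpow hq0 hq1.ne'

/-- Step 2 of the composition: `ω(ℂ) = 2` and fast determinant multiples (stub 3) give the crux's
statement (written UNFOLDED here so that exactly one theorem of this file, `CheapIdealMember_of`, concludes
the crux decl by name — the skeleton audit takes "the first" such theorem) — at `ε/2`,
`C · r^(2+ε/2) ≤ r^(2+ε)` as soon as `r^(ε/2) ≥ C`, so the body holds eventually, hence frequently.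
[cite: Blaser2013, Thm. 5.2] -/
theorem cheapIdealMember_of_omega_eq_two
    (hω : Literature.Computability.AlgebraicComplexity.omega ℂ = 2) (h₃ : FastDetMultiple) :
    ∀ ε : ℝ, 0 < ε → ∃ᶠ r : ℕ in Filter.atTop, ∃ g : MvPolynomial (Fin r × Fin r) ℂ, g ≠ 0 ∧
      (complexity (g * detPoly (Fin r) ℂ) : ℝ) ≤ (r : ℝ) ^ (2 + ε) := by
  intro ε hε
  have hε2 : (0 : ℝ) < ε / 2 := by positivity
  obtain ⟨C, hC⟩ := h₃ (ε / 2) hε2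
  rw [hω] at hC
  refine Filter.Eventually.frequently ?_
  have hlim : Tendsto (fun n : ℕ => (n : ℝ) ^ (ε / 2)) atTop atTop :=
    (tendsto_rpow_atTop hε2).comp tendsto_natCast_atTop_atTop
  filter_upwards [Filter.eventually_ge_atTop 1, hlim.eventually_ge_atTop C] with r hr1 hrC
  obtain ⟨g, hg, hgc⟩ := hC r hr1
  refine ⟨g, hg, hgc.trans ?_⟩
  have hr0 : (0 : ℝ) < (r : ℝ) := by exact_mod_cast hr1
  calc C * (r : ℝ) ^ (2 + ε / 2) ≤ (r : ℝ) ^ (ε / 2) * (r : ℝ) ^ (2 + ε / 2) :=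
        mul_le_mul_of_nonneg_right hrC (by positivity)
    _ = (r : ℝ) ^ (2 + ε) := by rw [← Real.rpow_add hr0]; congr 1; ring

/-- **The composition with explicit hypotheses (sorry-free): stub 1 → stub 2 → stub 3 → the crux's
statement** (conclusion = `CheapIdealMember` unfolded, definitionally; the by-name conclusion is
`CheapIdealMember_of` below, whose proof term is this one applied to the three stubs).
[cite: Andrews2022, Thm. 3; Blaser2013, Thm. 6.6, Thm. 5.2] -/
theorem CheapIdealMember_of_stubs
    (h₁ : ∀ ε : ℝ, 0 < ε → ∃ᶠ r : ℕ in Filter.atTop,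
      ∃ P : MvPolynomial (Fin r × Fin r) (Polynomial ℂ),
        MvPolynomial.map (Polynomial.evalRingHom 0) P ≠ 0 ∧
        detPoly (Fin r) ℂ ∣ MvPolynomial.map (Polynomial.evalRingHom 0) P ∧
        (complexity (MvPolynomial.map (algebraMap (Polynomial ℂ) (RatFunc ℂ)) P) : ℝ) ≤
          (r : ℝ) ^ (2 + ε))
    (h₂ : ∀ (r : ℕ) (P : MvPolynomial (Fin r × Fin r) (Polynomial ℂ)),
      MvPolynomial.map (Polynomial.evalRingHom 0) P ≠ 0 →
      detPoly (Fin r) ℂ ∣ MvPolynomial.map (Polynomial.evalRingHom 0) P →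
      algBorderRank (matMulTensor ℂ (r / 4) (r / 4) (r / 4)) ≤
        6 * complexity (MvPolynomial.map (algebraMap (Polynomial ℂ) (RatFunc ℂ)) P))
    (h₃ : FastDetMultiple) :
    ∀ ε : ℝ, 0 < ε → ∃ᶠ r : ℕ in Filter.atTop, ∃ g : MvPolynomial (Fin r × Fin r) ℂ, g ≠ 0 ∧
      (complexity (g * detPoly (Fin r) ℂ) : ℝ) ≤ (r : ℝ) ^ (2 + ε) :=
  cheapIdealMember_of_omega_eq_two (omega_eq_two_of_border h₁ h₂) h₃

/-! ## Sorry-free remark: the crux implies stub 1 (`C⁻` is a RELAXATION of the crux, not a costume) -/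

/-- Exact ⇒ border: a cheap exact multiple `g · det X_r` over `ℂ` is a cheap border member — take
`P := (g · det X_r)` with constant coefficients in `ℂ ⊂ ℂ[ε]`; its image over `ℂ(ε)` is computed by the
same circuit (`complexity_map_le`, extension of scalars is free). [cite: Burgisser2000, §4.1] -/
theorem border_witness_of_cheapIdealMember (hX : CheapIdealMember) :
    ∀ ε : ℝ, 0 < ε → ∃ᶠ r : ℕ in Filter.atTop,
      ∃ P : MvPolynomial (Fin r × Fin r) (Polynomial ℂ),
        MvPolynomial.map (Polynomial.evalRingHom 0) P ≠ 0 ∧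
        detPoly (Fin r) ℂ ∣ MvPolynomial.map (Polynomial.evalRingHom 0) P ∧
        (complexity (MvPolynomial.map (algebraMap (Polynomial ℂ) (RatFunc ℂ)) P) : ℝ) ≤
          (r : ℝ) ^ (2 + ε) := by
  intro ε hε
  refine (hX ε hε).mono fun r ⟨g, hg, hc⟩ => ?_
  refine ⟨MvPolynomial.map (Polynomial.C) (g * detPoly (Fin r) ℂ), ?_, ?_, ?_⟩
  · have hcomp : (Polynomial.evalRingHom (0 : ℂ)).comp Polynomial.C = RingHom.id ℂ := by
      ext c; simp
    rw [MvPolynomial.map_map, hcomp, MvPolynomial.map_id]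
    exact mul_ne_zero hg (Matrix.det_mvPolynomialX_ne_zero (Fin r) ℂ)
  · have hcomp : (Polynomial.evalRingHom (0 : ℂ)).comp Polynomial.C = RingHom.id ℂ := by
      ext c; simp
    rw [MvPolynomial.map_map, hcomp, MvPolynomial.map_id]
    exact dvd_mul_left _ _
  · rw [MvPolynomial.map_map]
    refine le_trans ?_ hc
    exact_mod_cast Literature.Computability.AlgebraicComplexity.ArithCircuit.complexity_map_le _ _

/-- **Registered conclusion — the skeleton theorem**: the crux `CheapIdealMember` BY NAME from the three
stubs (kernel-checked composition; closed only through the stubs' `sorry`s; the one theorem of this file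
whose conclusion is the route decl, so `#h21_check_skeleton` takes it). [cite: Andrews2022, Thm. 3] -/
theorem CheapIdealMember_of : CheapIdealMember :=
  CheapIdealMember_of_stubs stub_border_witness stub_andrews_border stub_fastDetMultiple

end Summit.MatrixMultiplication.MatrixMultiplication.Cruxes.CheapIdealMember.BorderLift
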